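import Mathlib
import Summits.QuantumAdvantage.QuantumAdvantage.Theorems.AbsorptionDialA

set_option linter.dupNamespace false

/-!
# AbsorptionDial (B) — «one loss ⟹ quasi-polynomially many losses» and the depth-three edge (cell decomp-qadv, lens 4, g14)

Prop-definition-free continuation of `AbsorptionDialA` (supports of item stmt-QuantumAdvantage-26994 ≡ 26767):

* `const_mul_pow_le_two_pow`, `schedule_le` — growth bookkeeping (`c·L^A ≤ 2^L`; the window schedule
  `L^C + 2·L^A·L^C + 1 ≤ (L−1)^(2(A+C)+3)`);
* `perfect_of_few_losses_prefix` — the prefix (`q = 0`) form of the lens law;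
* `quasiManyLoss_of_noPerfect` — **X ⟹ QML with the hypothesis spelled out**: if for every exponent `C'` no strategy of
  cut degree `≤ (log₂ n)^C'` is perfect for large `n`, then for all `C, A`, for large `n`, every strategy of cut degree
  `≤ (log₂ n)^C` loses on at least `2^((log₂ n)^A)` inputs (the converse, `A = 0`, is `noPerfect_of_quasiManyLoss`);
* `edgeStrategy`, `edge_perfect`, `fibrePerfect_of_xorRep` — **the outer edge**: an exact representation of the three
  MOD-3 residue indicators of `|w|` as parities of `s` Boolean functions of `𝔽_p`-degree `≤ d` each (an exact
  `MOD₂ ∘ MOD_p ∘ AND_d` formula of top fan-in `3s`) IS a degree-`d` strategy that wins on the whole co-dimension-`3s`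
  fibre `0^{3s} ++ w`.

0 sorry; axioms standard; no `instance`, no `notation`, no `native_decide`.
-/

open Finset
open Literature.Computability.MetaComplexity Literature.Computability.MetaComplexity.Smolensky
open Summit.QuantumAdvantage.AdviceFreeQNC0

namespace Summit.QuantumAdvantage.QuantumAdvantage.Theorems.AbsorptionDial

variable {p : ℕ} [Fact p.Prime]

/-! ## Growth bookkeeping -/

/-- growth: `c·L^A ≤ 2^L` for large `L`. -/
theorem const_mul_pow_le_two_pow (c A : ℕ) : ∃ L₀ : ℕ, ∀ L ≥ L₀, c * L ^ A ≤ 2 ^ L := by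
  have h := tendsto_pow_const_div_const_pow_of_one_lt A (one_lt_two : (1 : ℝ) < 2)
  have hev : ∀ᶠ L : ℕ in Filter.atTop, (L : ℝ) ^ A / 2 ^ L < 1 / (c + 1) :=
    h.eventually_lt_const (by positivity)
  obtain ⟨L₀, hL₀⟩ := Filter.eventually_atTop.mp hev
  refine ⟨L₀, fun L hL => ?_⟩
  have h1 := hL₀ L hL
  have h2 : (0 : ℝ) < 2 ^ L := by positivity
  have hc : (0 : ℝ) < c + 1 := by positivity
  rw [div_lt_div_iff₀ h2 hc, one_mul] at h1
  have h3 : ((c * L ^ A : ℕ) : ℝ) < ((2 ^ L : ℕ) : ℝ) := by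
    push_cast; nlinarith [pow_nonneg (Nat.cast_nonneg L : (0 : ℝ) ≤ L) A]
  exact (by exact_mod_cast h3 : c * L ^ A < 2 ^ L).le

/-- growth: `2·L^A ≤ 2^L` for large `L`. -/
theorem two_mul_pow_le_two_pow (A : ℕ) : ∃ L₀ : ℕ, ∀ L ≥ L₀, 2 * L ^ A ≤ 2 ^ L :=
  const_mul_pow_le_two_pow 2 A

/-- the degree schedule of the absorption: `L^C + 2·L^A·L^C + 1 ≤ (L − 1)^(2(A+C)+3)` for `L ≥ 3`. -/
theorem schedule_le {L A C : ℕ} (hL : 3 ≤ L) :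
    L ^ C + (2 * (L ^ A * L ^ C) + 1) ≤ (L - 1) ^ (2 * (A + C) + 3) := by
  have hX1 : L ^ C ≤ L ^ (A + C) := Nat.pow_le_pow_right (by omega) (by omega)
  have hX2 : L ^ A * L ^ C = L ^ (A + C) := by rw [pow_add]
  have hX3 : 1 ≤ L ^ (A + C) := Nat.one_le_pow _ _ (by omega)
  have h4 : L ^ C + (2 * (L ^ A * L ^ C) + 1) ≤ 4 * L ^ (A + C) := by
    rw [hX2]; omega
  have hsq : L ≤ (L - 1) ^ 2 := by
    obtain ⟨t, rfl⟩ : ∃ t, L = t + 3 := ⟨L - 3, by omega⟩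
    rw [show t + 3 - 1 = t + 2 by omega]; nlinarith [sq_nonneg t]
  have h5 : L ^ (A + C) ≤ ((L - 1) ^ 2) ^ (A + C) := Nat.pow_le_pow_left hsq _
  have h6 : 2 ^ 3 ≤ (L - 1) ^ 3 := Nat.pow_le_pow_left (by omega) 3
  calc L ^ C + (2 * (L ^ A * L ^ C) + 1) ≤ 4 * L ^ (A + C) := h4
    _ ≤ (L - 1) ^ 3 * ((L - 1) ^ 2) ^ (A + C) := Nat.mul_le_mul (by omega) h5
    _ = (L - 1) ^ (2 * (A + C) + 3) := by ring

/-- the lens law on a PREFIX-frozen window (`q = 0`), degrees tidied. -/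
theorem perfect_of_few_losses_prefix {k ℓ : ℕ} (hℓ : 1 ≤ ℓ) {d : ℕ} (c : ℕ)
    (y : Fin (k + ℓ + 1) → (Fin (k + ℓ) → Bool) → Bool) (hy : ∀ g, HasDegF p (y g) d)
    (h : (univ.filter fun u : Fin (k + ℓ) → Bool => ringWinU c y u = false).card < 2 ^ k) :
    ∃ c' : ℕ, ∃ y' : Fin (ℓ + 1) → (Fin ℓ → Bool) → Bool,
      (∀ g, HasDegF p (y' g) (d + (2 * (k * d) + 1))) ∧ ∀ w, ringWinU c' y' w = true := by
  obtain ⟨c', y', hy', hp⟩ := perfect_of_few_losses (k := k) (ℓ := ℓ) (q := 0) c y hℓ hy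
    (by rw [pow_zero, mul_one]; exact h)
  exact ⟨c', y', fun g => by simpa using hy' g, hp⟩


/-- **X ⟹ QML (hypothesis spelled out).**  If no polylog-degree strategy is perfect for large `n` (for EVERY degree
exponent), then for every `A` every strategy of cut degree `≤ (log₂ n)^C` loses on at least `2^((log₂ n)^A)` inputs:
freeze a prefix of `(log₂ n)^A` bits; fewer losses than prefixes would leave a loss-free fibre, whose ABSORBED window
strategy is a perfect plain strategy of polylog degree on `n − (log₂ n)^A` bits. -/
theorem quasiManyLoss_of_noPerfect
    (hX : ∀ C : ℕ, ∃ n₀ : ℕ, ∀ n ≥ n₀, ∀ c : ℕ, ∀ y : Fin (n + 1) → (Fin n → Bool) → Bool,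
      (∀ g, HasDegF p (y g) ((Nat.log 2 n) ^ C)) → ∃ u, ringWinU c y u = false)
    (C A : ℕ) : ∃ n₀ : ℕ, ∀ n ≥ n₀, ∀ c : ℕ, ∀ y : Fin (n + 1) → (Fin n → Bool) → Bool,
      (∀ g, HasDegF p (y g) ((Nat.log 2 n) ^ C)) →
        2 ^ ((Nat.log 2 n) ^ A) ≤ (univ.filter fun u : Fin n → Bool => ringWinU c y u = false).card := by
  obtain ⟨n₁, hn₁⟩ := hX (2 * (A + C) + 3)
  obtain ⟨L₀, hL₀⟩ := two_mul_pow_le_two_pow A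
  refine ⟨max (2 ^ (max L₀ 3)) (2 * n₁ + 2), fun n hn c y hy => ?_⟩
  obtain ⟨L, hL⟩ : ∃ L, L = Nat.log 2 n := ⟨_, rfl⟩
  rw [← hL] at hy ⊢
  have hn0 : n ≠ 0 := by have := le_trans (le_max_right _ _) hn; omega
  have hLge : max L₀ 3 ≤ L := hL ▸ Nat.le_log_of_pow_le one_lt_two (le_trans (le_max_left _ _) hn)
  have hL3 : 3 ≤ L := le_trans (le_max_right _ _) hLge
  have h2L : 2 ^ L ≤ n := hL ▸ Nat.pow_log_le_self 2 hn0
  have hk : 2 * L ^ A ≤ 2 ^ L := hL₀ L (le_trans (le_max_left _ _) hLge)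
  have hn2 : 2 * n₁ + 2 ≤ n := le_trans (le_max_right _ _) hn
  obtain ⟨ℓ, rfl⟩ : ∃ ℓ, n = L ^ A + ℓ := ⟨n - L ^ A, by omega⟩
  have hℓ1 : 1 ≤ ℓ := by omega
  have hℓn₁ : n₁ ≤ ℓ := by omega
  have hpow : 2 ^ L = 2 * 2 ^ (L - 1) := by
    rw [← pow_succ']; congr 1; omega
  have hℓlog : L - 1 ≤ Nat.log 2 ℓ := Nat.le_log_of_pow_le one_lt_two (by omega)
  by_contra hlt
  rw [not_le] at hlt
  -- fewer than `2^(L^A)` losses: a loss-free prefix fibre, absorbed into a perfect plain strategy on `ℓ` bits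
  obtain ⟨c', y', hy', hperf⟩ := perfect_of_few_losses_prefix (k := L ^ A) (ℓ := ℓ) hℓ1 c y hy hlt
  have hdeg : ∀ g, HasDegF p (y' g) ((Nat.log 2 ℓ) ^ (2 * (A + C) + 3)) := fun g => by
    have h := hy' g
    unfold HasDegF at h ⊢
    exact lowDeg_mono ((schedule_le hL3).trans (Nat.pow_le_pow_left hℓlog _)) h
  obtain ⟨w, hw⟩ := hn₁ ℓ hℓn₁ c' y' hdeg
  rw [hperf w] at hw
  exact Bool.noConfusion hw

/-- **QML ⟹ X** at `A = 0`: two losses are at least one. -/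
theorem noPerfect_of_quasiManyLoss {n c : ℕ} {y : Fin (n + 1) → (Fin n → Bool) → Bool}
    (h : 2 ^ ((Nat.log 2 n) ^ 0) ≤ (univ.filter fun u : Fin n → Bool => ringWinU c y u = false).card) :
    ∃ u, ringWinU c y u = false := by
  rw [pow_zero, pow_one] at h
  obtain ⟨u, hu⟩ := Finset.card_pos.mp (lt_of_lt_of_le (by norm_num) h)
  exact ⟨u, (Finset.mem_filter.mp hu).2⟩

/-! ## The outer edge: exact `MOD₂ ∘ MOD_p ∘ AND_d` representations of MOD₃ are fibre-perfect strategies -/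

section Edge

variable {s ℓ : ℕ}

/-- the CDH strategy on `3s + ℓ` bits: prefix cut `i < 3s` plays `F i` on the window (the last `ℓ` bits); every other cut
is silent. -/
def edgeStrategy (F : Fin (3 * s) → (Fin ℓ → Bool) → Bool) :
    Fin (3 * s + ℓ + 1) → (Fin (3 * s + ℓ) → Bool) → Bool := fun g u =>
  if h : g.val < 3 * s then F ⟨g.val, h⟩ (fun j => u (Fin.natAdd (3 * s) j)) else false

/-- the CDH strategy has cut degree `≤ d`. -/
theorem hasDegF_edgeStrategy {d : ℕ} {F : Fin (3 * s) → (Fin ℓ → Bool) → Bool} (hF : ∀ i, HasDegF p (F i) d)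
    (g : Fin (3 * s + ℓ + 1)) : HasDegF p (edgeStrategy F g) d := by
  by_cases h : g.val < 3 * s
  · have e : edgeStrategy F g = fun u => F ⟨g.val, h⟩ (fun j => u (Fin.natAdd (3 * s) j)) := by
      funext u; unfold edgeStrategy; rw [dif_pos h]
    rw [e]
    have := hF ⟨g.val, h⟩
    unfold HasDegF at this ⊢
    exact comp_subst_mem_lowDeg (fun (u : Fin (3 * s + ℓ) → Bool) (j : Fin ℓ) => u (Fin.natAdd (3 * s) j))
      (fun j => Or.inr ⟨Fin.natAdd (3 * s) j, fun _ => rfl⟩) this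
  · have e : edgeStrategy F g = fun _ => false := by
      funext u; unfold edgeStrategy; rw [dif_neg h]
    rw [e]; exact RigidityLaws.hasDegF_const p false d

/-- the window fibre over the frozen prefix `0^{3s}`. -/
def edgeInput (s : ℕ) (w : Fin ℓ → Bool) : Fin (3 * s + ℓ) → Bool := Fin.append (fun _ : Fin (3 * s) => false) w

/-- AbsorptionDialB helper `wt_edgeInput` (decomp-qadv land package; see the module docstring). -/
theorem wt_edgeInput (w : Fin ℓ → Bool) : wt (edgeInput s w) = wt w := by
  unfold edgeInput; rw [wt_append]; simp [wt]

/-- AbsorptionDialB helper `walkExp_edgeInput` (decomp-qadv land package; see the module docstring). -/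
theorem walkExp_edgeInput {i : ℕ} (hi : i ≤ 3 * s) (w : Fin ℓ → Bool) : walkExp (edgeInput s w) i = wt w := by
  unfold walkExp; rw [wt_edgeInput]; unfold edgeInput; rw [wtPrefix_append_of_le _ _ hi]; simp [wtPrefix]

/-- **CDH EMBEDDING.**  An exact `MOD₂ ∘ MOD_p ∘ AND_d` representation table of MOD₃ on `ℓ` bits with top fan-in `s` IS a
cut-degree-`d` strategy on `3s + ℓ` bits that WINS the u-walk game (charge `0`) on EVERY point of the window fibre
`0^{3s} × {0,1}^ℓ` (co-dimension `3s`).  Hence any «window-exactness» law at co-dimension `3s` and degree `d` — no degree-`d`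
strategy is perfect on a co-dimension-`3s` window fibre — is AT LEAST an exact-representation lower bound
«MOD₃ ∉ MOD₂ ∘ MOD_p ∘ AND_d of top fan-in `s`» on `ℓ` bits. -/
theorem edge_perfect {F : Fin (3 * s) → (Fin ℓ → Bool) → Bool}
    (hpar : ∀ ρ : ℕ, ρ < 3 → ∀ w : Fin ℓ → Bool,
      (univ.filter fun i : Fin (3 * s) => i.val % 3 = ρ ∧ F i w = true).card % 2 =
        if wt w % 3 = (2 * ρ + 1) % 3 then 1 else 0)
    (w : Fin ℓ → Bool) :
    ringWinU 0 (edgeStrategy F) (edgeInput s w) = true := by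
  classical
  unfold ringWinU
  rw [decide_eq_true_eq]
  -- Step 1: only the prefix cuts fire; cut `i` is live iff `(i + |w|) % 3 ≠ 0`
  have hval : ∀ g : Fin (3 * s + ℓ + 1), ¬ g.val < 3 * s →
      (if edgeStrategy F g (edgeInput s w) = true ∧ (0 + g.val + walkExp (edgeInput s w) g.val) % 3 ≠ 0
        then 1 else 0) = 0 := by
    intro g hg
    have : edgeStrategy F g (edgeInput s w) = false := by unfold edgeStrategy; rw [dif_neg hg]
    simp [this]
  have hcount : (univ.filter fun g : Fin (3 * s + ℓ + 1) =>
        edgeStrategy F g (edgeInput s w) = true ∧ (0 + g.val + walkExp (edgeInput s w) g.val) % 3 ≠ 0).card =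
      (univ.filter fun i : Fin (3 * s) => F i w = true ∧ (i.val + wt w) % 3 ≠ 0).card := by
    rw [Finset.card_filter, Finset.card_filter, Fin.sum_univ_castSucc, Fin.sum_univ_add]
    rw [hval (Fin.last _) (by simp), Finset.sum_eq_zero (fun (j : Fin ℓ) _ => hval _ (by simp)), add_zero, add_zero]
    refine Finset.sum_congr rfl fun i _ => ?_
    have e1 : edgeStrategy F (Fin.castSucc (Fin.castAdd ℓ i)) (edgeInput s w) = F i w := by
      unfold edgeStrategy
      rw [dif_pos (by simp [i.isLt])]
      congr 1
      funext j; unfold edgeInput; exact Fin.append_right _ _ j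
    have e2 : walkExp (edgeInput s w) (Fin.castSucc (Fin.castAdd ℓ i)).val = wt w :=
      walkExp_edgeInput (by simp) w
    rw [e1, e2]
    simp only [Fin.val_castSucc, Fin.val_castAdd, Nat.zero_add]
  rw [hcount]
  -- Step 2: split the live firing cuts by class `i mod 3`
  rw [Finset.card_eq_sum_card_fiberwise (t := Finset.range 3) (f := fun i : Fin (3 * s) => i.val % 3)
    (fun i _ => Finset.mem_coe.mpr (Finset.mem_range.mpr (Nat.mod_lt _ (by norm_num))))]
  have hfib : ∀ ρ : ℕ, ((univ.filter fun i : Fin (3 * s) => F i w = true ∧ (i.val + wt w) % 3 ≠ 0).filter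
      fun i => i.val % 3 = ρ).card = if (ρ + wt w % 3) % 3 ≠ 0 then
        (univ.filter fun i : Fin (3 * s) => i.val % 3 = ρ ∧ F i w = true).card else 0 := by
    intro ρ
    split_ifs with hlive
    · rw [Finset.filter_filter]
      congr 1
      exact Finset.filter_congr fun i _ =>
        ⟨fun h => ⟨h.2, h.1.1⟩, fun h => ⟨⟨h.2, fun h0 => hlive (by omega)⟩, h.1⟩⟩
    · rw [Finset.filter_filter, Finset.card_eq_zero, Finset.filter_eq_empty_iff]
      intro i _ h
      exact hlive (by omega)
  simp only [hfib]
  rw [Finset.sum_range_succ, Finset.sum_range_succ, Finset.sum_range_succ, Finset.sum_range_zero, zero_add]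
  have h0 := hpar 0 (by norm_num) w
  have h1 := hpar 1 (by norm_num) w
  have h2 := hpar 2 (by norm_num) w
  obtain ⟨r, hr, hr3⟩ : ∃ r, wt w % 3 = r ∧ r < 3 := ⟨_, rfl, Nat.mod_lt _ (by norm_num)⟩
  rw [hr] at h0 h1 h2 ⊢
  generalize (univ.filter fun i : Fin (3 * s) => i.val % 3 = 0 ∧ F i w = true).card = N0 at h0 ⊢
  generalize (univ.filter fun i : Fin (3 * s) => i.val % 3 = 1 ∧ F i w = true).card = N1 at h1 ⊢
  generalize (univ.filter fun i : Fin (3 * s) => i.val % 3 = 2 ∧ F i w = true).card = N2 at h2 ⊢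
  interval_cases r <;> simp at h0 h1 h2 ⊢ <;> omega

/-- **the edge, packaged**: an exact `MOD₂ ∘ MOD_p ∘ AND_d` representation of the three MOD-3 residue indicators of
`|w|` with top fan-in `3s` (hypotheses `hdeg`, `hpar`) yields a cut-degree-`d` strategy on `3s + ℓ` bits and a frozen
prefix `a` such that the strategy wins on the WHOLE fibre `a ++ w` — the converse direction of the window method:
window-exactness at co-dimension `3s` is at least as hard as refuting such representations. -/
theorem fibrePerfect_of_xorRep {d : ℕ} {F : Fin (3 * s) → (Fin ℓ → Bool) → Bool} (hdeg : ∀ i, HasDegF p (F i) d)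
    (hpar : ∀ ρ : ℕ, ρ < 3 → ∀ w : Fin ℓ → Bool,
      (univ.filter fun i : Fin (3 * s) => i.val % 3 = ρ ∧ F i w = true).card % 2 =
        if wt w % 3 = (2 * ρ + 1) % 3 then 1 else 0) :
    ∃ (c : ℕ) (y : Fin (3 * s + ℓ + 1) → (Fin (3 * s + ℓ) → Bool) → Bool) (a : Fin (3 * s) → Bool),
      (∀ g, HasDegF p (y g) d) ∧ ∀ w : Fin ℓ → Bool, ringWinU c y (Fin.append a w) = true :=
  ⟨0, edgeStrategy F, fun _ => false, hasDegF_edgeStrategy hdeg, edge_perfect hpar⟩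

end Edge

end Summit.QuantumAdvantage.QuantumAdvantage.Theorems.AbsorptionDial
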